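import Literature.MathematicalPhysics.KineticTheory.HardSphereMarginalTrace
import Literature.Analysis.FluidPDE.HardSphereCollisionRecord
import Literature.Analysis.FluidPDE.ControlledHardSphereDynamics
import HarnessLib

/-!
# Energy-separated clusters of a hard-sphere orbit are autonomous during a short time window

Brick `stub_eqMomentClusterAutonomy` (registered sub-goal) toward the stub `stub_eqMoment` of the
line `Sketch` of the crux `ContactAngleEquidistribution` (stmt-AtomisticToContinuum-12097, route
LambertianContactSwap): the uniform-in-`N` second moment of the equilibrium collision count is to be
controlled WITHOUT mesh refinement by charging the collisions of a window `[a, a + h]` to STATIC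
clusters of the configuration at the window start.  This file is the deterministic core of that
reduction, for any realisation `Φ` of Alexander's hard-sphere flow on `𝕋^d` and any good datum:

* `window_induction` — induction along a hard-sphere trajectory over the finitely many collision
  times of a window (free stretches / one collision at a time);
* `exists_eq_collidePair_freeFlight` — across a collision-free stretch `(s, t)` ending at a collision
  time, `γ t = collidePair p q (S_{t-s} (γ s))` for an incoming contact pair `(p, q)`;
* `euclidDist_flow_le_of_norm_vel_le` — a speed bound `u` on `[t₁, t₂)` bounds the minimal-image
  displacement by `u (t₂ - t₁)`;
* `blockEnergy_flow_eq_of_intra` — if all collisions in `(a, t]` are intra-block, block kinetic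
  energies are conserved;
* `stub_eqMomentClusterAutonomy` — **if at time `a` any two particles of different blocks are at
  distance `> ε + (b - a)(√(2E_α) + √(2E_β))` (`E_α` the kinetic energy of a block at time `a`), then
  on `[a, b]` all collisions are intra-block, block energies are conserved, speeds are bounded by
  `√(2E)` of the own block and displacements by `(t - a) √(2E)`** (first cross-block collision
  argument).  No smallness, no measure theory: GST 2013 Def. 4.1.2 (piecewise free flight, continuous
  positions, binary elastic collisions) is all that is used; this is the finite-volume, pathwise form
  of the cluster property behind Alexander's construction of the infinite dynamics (Alexander 1975).

## References

* I. Gallagher, L. Saint-Raymond, B. Texier, *From Newton to Boltzmann*, EMS (2013), §4.1,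
  Def. 4.1.2, Prop. 4.1.1.  [GST2013]
* R. K. Alexander, *The infinite hard sphere system*, Ph.D. thesis, Berkeley (1975).  [Alexander1975]
-/

noncomputable section

open MeasureTheory Filter Set Topology Function
open scoped ENNReal InnerProductSpace BigOperators Classical

namespace Summit.AtomisticToContinuum.HydrodynamicLimit.Theorems.ContactAngleEquidistributionSketch

open Literature.Analysis.FluidPDE Literature.MathematicalPhysics.KineticTheory

variable {d : Type*} [Fintype d] {N : ℕ} {ε : ℝ}

/-! ## Orbit induction over the collision times of a window -/

section Trajectory

variable {X : Type*} [TopologicalSpace X] {G : Geometry d X} {γ : ℝ → Config N d X}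

/-- **Induction along a hard-sphere trajectory over a window `[a, b]`.**  A property `Q` of times
holds on all of `[a, b]` as soon as it holds at `a`, propagates along collision-free stretches
`(s, t]`, and propagates across a collision time `t` reached by a collision-free open stretch
`(s, t)` from a time `s` where it holds (the collision times in `(a, t]` are finitely many,
`IsHardSphereTrajectory.locFinite`; strong induction on their number, peeling off the last one).
[folklore] -/
theorem window_induction (hγ : IsHardSphereTrajectory G ε N γ) {a b : ℝ}
    (Q : ℝ → Prop) (ha : Q a)
    (hfree : ∀ s t, a ≤ s → s ≤ t → t ≤ b → Q s →
      (∀ σ ∈ Ioc s t, σ ∉ collisionTimes G ε γ) → Q t)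
    (hjump : ∀ s t, a ≤ s → s < t → t ≤ b → Q s →
      (∀ σ ∈ Ioo s t, σ ∉ collisionTimes G ε γ) → t ∈ collisionTimes G ε γ → Q t) :
    ∀ t ∈ Icc a b, Q t := by
  have hfin : ∀ t, (collisionTimes G ε γ ∩ Ioc a t).Finite := fun t =>
    (hγ.locFinite a t).subset (inter_subset_inter_right _ Ioc_subset_Icc_self)
  -- no collision in `(a, t]`: a single free stretch
  have hempty : ∀ t ∈ Icc a b, (hfin t).toFinset = ∅ → Q t := fun t ht he =>
    hfree a t le_rfl ht.1 ht.2 ha fun σ hσ hσc =>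
      Finset.notMem_empty σ (he ▸ (hfin t).mem_toFinset.2 ⟨hσc, hσ⟩)
  suffices H : ∀ (n : ℕ) (t : ℝ), t ∈ Icc a b → (hfin t).toFinset.card ≤ n → Q t from
    fun t ht => H _ t ht le_rfl
  intro n
  induction n with
  | zero => exact fun t ht hcard => hempty t ht (Finset.card_eq_zero.1 (Nat.le_zero.1 hcard))
  | succ n ih =>
    intro t ht hcard
    by_cases hne : (hfin t).toFinset.Nonempty
    swap
    · exact hempty t ht (Finset.not_nonempty_iff_eq_empty.1 hne)
    -- the last collision time `s⋆ ∈ (a, t]`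
    set sStar : ℝ := (hfin t).toFinset.max' hne with hsStar_def
    have hsStar : sStar ∈ collisionTimes G ε γ ∩ Ioc a t :=
      (hfin t).mem_toFinset.1 ((hfin t).toFinset.max'_mem hne)
    have hle_sStar : ∀ σ ∈ collisionTimes G ε γ ∩ Ioc a t, σ ≤ sStar := fun σ hσ =>
      (hfin t).toFinset.le_max' σ ((hfin t).mem_toFinset.2 hσ)
    -- a time `s₀ ∈ [a, s⋆)` with `(s₀, s⋆)` collision-free and at most `n` collisions in `(a, s₀]`
    obtain ⟨s₀, has₀, hs₀, hfree₀, hcard₀⟩ : ∃ s₀, a ≤ s₀ ∧ s₀ < sStar ∧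
        (∀ σ ∈ Ioo s₀ sStar, σ ∉ collisionTimes G ε γ) ∧ (hfin s₀).toFinset.card ≤ n := by
      set F' : Finset ℝ := (hfin t).toFinset.erase sStar with hF'
      have hF'card : F'.card ≤ n := by
        have h1 := Finset.card_erase_of_mem ((hfin t).toFinset.max'_mem hne)
        rw [← hsStar_def] at h1
        rw [hF', h1]
        omega
      -- every collision time of `(a, σ']`, `σ' < s⋆`, lies in `F'`
      have hmemF' : ∀ σ, σ ∈ collisionTimes G ε γ → a < σ → σ < sStar → σ ∈ F' :=
        fun σ hσc hσa hσs => Finset.mem_erase.2 ⟨ne_of_lt hσs,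
          (hfin t).mem_toFinset.2 ⟨hσc, hσa, hσs.le.trans hsStar.2.2⟩⟩
      have hsub : ∀ s₀, s₀ < sStar → (hfin s₀).toFinset ⊆ F' := fun s₀ hs₀ σ hσ =>
        have h := (hfin s₀).mem_toFinset.1 hσ
        hmemF' σ h.1 h.2.1 (h.2.2.trans_lt hs₀)
      by_cases hne' : F'.Nonempty
      · obtain ⟨hne_s, hmem_s⟩ := Finset.mem_erase.1 (F'.max'_mem hne')
        obtain ⟨hcs, has, hst⟩ := (hfin t).mem_toFinset.1 hmem_s
        have hlt : F'.max' hne' < sStar := lt_of_le_of_ne (hle_sStar _ ⟨hcs, has, hst⟩) hne_s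
        refine ⟨F'.max' hne', has.le, hlt, fun σ hσ hσc => ?_,
          (Finset.card_le_card (hsub _ hlt)).trans hF'card⟩
        -- a collision time in `(max F', s⋆)` would be in `F'` and exceed its maximum
        exact (not_lt.2 (F'.le_max' σ (hmemF' σ hσc (has.trans hσ.1) hσ.2))) hσ.1
      · refine ⟨a, le_rfl, hsStar.2.1, fun σ hσ hσc => hne' ⟨σ, hmemF' σ hσc hσ.1 hσ.2⟩, ?_⟩
        have : (hfin a).toFinset = ∅ := Finset.eq_empty_iff_forall_notMem.2 fun σ hσ =>
          have h := (hfin a).mem_toFinset.1 hσ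
          (not_lt.2 h.2.2) h.2.1
        rw [this, Finset.card_empty]
        exact Nat.zero_le _
    have hsStar_b : sStar ≤ b := hsStar.2.2.trans ht.2
    have hQ₀ : Q s₀ := ih s₀ ⟨has₀, hs₀.le.trans hsStar_b⟩ hcard₀
    have hQ₁ : Q sStar := hjump s₀ sStar has₀ hs₀ hsStar_b hQ₀ hfree₀ hsStar.1
    exact hfree sStar t hsStar.2.1.le hsStar.2.2 ht.2 hQ₁ fun σ hσ hσc =>
      (not_lt.2 (hle_sStar σ ⟨hσc, hsStar.2.1.trans hσ.1, hσ.2⟩)) hσ.1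

/-- **The collision step made explicit.**  If `(s, t)` is collision-free, `s < t`, and `t` is a
collision time of a hard-sphere trajectory (Hausdorff position space, continuous translations),
then the value at `t` is the elastic reflection of some incoming contact pair `(p, q)` of the
free-flight configuration `S_{t-s} (γ s)`, which is the left limit at `t`
(`IsHardSphereTrajectory.eq_collidePair_leftLim`, `leftLim_eq_freeFlight`). [folklore] -/
theorem exists_eq_collidePair_freeFlight [T2Space X]
    (hγ : IsHardSphereTrajectory G ε N γ) (hG : ∀ x : X, Continuous (G.translate x)) {s t : ℝ}
    (hst : s < t) (hfree : ∀ σ ∈ Ioo s t, σ ∉ collisionTimes G ε γ)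
    (ht : t ∈ collisionTimes G ε γ) :
    ∃ p q : Fin N, p ≠ q ∧ γ t ∈ contactSet G N ε p q ∧
      IsIncoming G (freeFlight G (t - s) (γ s)) p q ∧
      γ t = collidePair G p q (freeFlight G (t - s) (γ s)) := by
  obtain ⟨p, q, hpq, hc⟩ := mem_collisionTimes.1 ht
  obtain ⟨hin, heq⟩ := hγ.eq_collidePair_leftLim hpq hc
  rw [hγ.leftLim_eq_freeFlight hG hst hfree] at hin heq
  exact ⟨p, q, hpq, hc, hin, heq⟩

end Trajectory

/-! ## Torus kinematics: displacement under a speed bound -/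

section Torus

variable (Φ : HardSphereFlow (Torus.geometry d) ε N) {z : Config N d (UnitAddTorus d)}

/-- **Displacement under a speed bound** (torus): if particle `i` has speed at most `u` at every
time of `[t₁, t₂)` along a good orbit, its minimal-image displacement between `t₁` and `t₂` is at
most `u (t₂ - t₁)` (free flight moves `x_i` by `(t - x) v_i(x)`; positions are continuous across
the locally finitely many collisions; continuous induction on `[t₁, t₂]`, which is why the bound at
the right end point `t₂` is not needed). [folklore] -/
theorem euclidDist_flow_le_of_norm_vel_le (hz : z ∈ Φ.good) (i : Fin N) {t₁ t₂ u : ℝ}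
    (h12 : t₁ ≤ t₂) (hu : ∀ s ∈ Ico t₁ t₂, ‖(Φ.flow s z i).2‖ ≤ u) :
    Torus.euclidDist (Φ.flow t₂ z i).1 (Φ.flow t₁ z i).1 ≤ u * (t₂ - t₁) := by
  -- adapted from `HardSphereFlow.euclidDist_flow_self_le` (HardSphereMarginalTrace), with the
  -- energy bound on the speed replaced by the hypothesis `hu`
  have hγ := Φ.isTrajectory z hz
  set P : ℝ → UnitAddTorus d := fun t => (Φ.flow t z i).1 with hP
  have hPc : Continuous P := hγ.pos_continuous i
  set S : Set ℝ := {t | Torus.euclidDist (P t) (P t₁) ≤ u * (t - t₁)} with hS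
  have hSc : IsClosed S := by
    have h1 : Continuous fun t => Torus.euclidDist (P t) (P t₁) := by
      simpa only [Function.comp_def] using
        Torus.continuous_euclidDist.comp (hPc.prodMk continuous_const)
    have h2 : Continuous fun t => u * (t - t₁) := by fun_prop
    exact isClosed_le h1 h2
  have hmem : t₁ ∈ S := by simp [hS, Torus.euclidDist_self]
  have key : Icc t₁ t₂ ⊆ S := by
    refine (hSc.inter isClosed_Icc).Icc_subset_of_forall_mem_nhdsWithin hmem ?_
    rintro x ⟨hxS, hx⟩
    obtain ⟨w, hxw, hfree⟩ := hγ.exists_Ioo_right_free x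
    refine mem_of_superset (Ioo_mem_nhdsGT hxw) fun t ht => ?_
    have hff : Φ.flow t z = freeFlight (Torus.geometry d) (t - x) (Φ.flow x z) :=
      hγ.eq_freeFlight_of_Ioo_free hfree ⟨ht.1.le, ht.2⟩
    have hstep : Torus.euclidDist (P t) (P x) ≤ u * (t - x) := by
      have h := Torus.euclidDist_translate_le (Φ.flow x z i).1 (Φ.flow x z i).1
        ((t - x) • (Φ.flow x z i).2) 0
      rw [Torus.euclidDist_self, zero_add, sub_zero, norm_smul,
        Real.norm_of_nonneg (sub_nonneg.2 ht.1.le),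
        Literature.Analysis.FunctionSpaces.Torus.proj_zero, add_zero] at h
      have hvi : ‖(Φ.flow x z i).2‖ ≤ u := hu x hx
      have hPt : P t = (Φ.flow x z i).1 +
          Literature.Analysis.FunctionSpaces.Torus.proj ((t - x) • (Φ.flow x z i).2) := by
        show (Φ.flow t z i).1 = _
        rw [hff, freeFlight_apply, Torus.geometry_translate]
      rw [hPt]
      calc _ ≤ (t - x) * ‖(Φ.flow x z i).2‖ := h
        _ ≤ (t - x) * u := by gcongr; linarith [ht.1]
        _ = u * (t - x) := by ring
    show Torus.euclidDist (P t) (P t₁) ≤ u * (t - t₁)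
    have hxS' : Torus.euclidDist (P x) (P t₁) ≤ u * (x - t₁) := hxS
    calc Torus.euclidDist (P t) (P t₁)
        ≤ Torus.euclidDist (P t) (P x) + Torus.euclidDist (P x) (P t₁) :=
          torus_euclidDist_triangle _ _ _
      _ ≤ u * (t - x) + u * (x - t₁) := add_le_add hstep hxS'
      _ = u * (t - t₁) := by ring
  exact key ⟨h12, le_rfl⟩

end Torus

/-! ## Block kinetic energies -/

section Blocks

variable {X : Type*} {ι : Type*}

/-- Free flight does not change the block kinetic energies (velocities are unchanged). [folklore] -/
theorem blockEnergy_freeFlight (G : Geometry d X) (cl : Fin N → ι) (α : ι) (τ : ℝ)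
    (w : Config N d X) :
    (∑ k, if cl k = α then ‖(freeFlight G τ w k).2‖ ^ 2 else 0) =
      ∑ k, if cl k = α then ‖(w k).2‖ ^ 2 else 0 := by
  simp only [freeFlight_apply]

/-- An elastic collision of a pair inside one block does not change the block kinetic energies
(`‖v_p'‖² + ‖v_q'‖² = ‖v_p‖² + ‖v_q‖²`, other velocities unchanged). [folklore] -/
theorem blockEnergy_collidePair (G : Geometry d X) (cl : Fin N → ι) {p q : Fin N} (hpq : p ≠ q)
    (hcl : cl p = cl q) (α : ι) (w : Config N d X) :
    (∑ k, if cl k = α then ‖(collidePair G p q w k).2‖ ^ 2 else 0) =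
      ∑ k, if cl k = α then ‖(w k).2‖ ^ 2 else 0 := by
  -- `sum_eq_sum_of_pair'` of `ControlledHardSphereDynamics`
  refine sum_eq_sum_of_pair' hpq ?_ fun k hkp hkq => by rw [collidePair_apply_of_ne hkp hkq]
  rw [collidePair_apply_left hpq, collidePair_apply_right, ← hcl]
  by_cases hα : cl p = α
  · simp only [hα, if_true]
    exact norm_sq_reflectVel_fst_add_norm_sq_reflectVel_snd _ _
  · simp only [hα, if_false, add_zero]

/-- A particle's speed is at most the square root of (twice) the kinetic energy of its block.
[folklore] -/
theorem norm_vel_le_sqrt_blockEnergy (cl : Fin N → ι) (w : Config N d X) (i : Fin N) :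
    ‖(w i).2‖ ≤ Real.sqrt (∑ k, if cl k = cl i then ‖(w k).2‖ ^ 2 else 0) := by
  refine Real.le_sqrt_of_sq_le ?_
  have h := Finset.single_le_sum (f := fun k => if cl k = cl i then ‖(w k).2‖ ^ 2 else 0)
    (fun k _ => by positivity) (Finset.mem_univ i)
  simpa only [if_true] using h

end Blocks

/-! ## The stub: energy-separated blocks are autonomous -/

section Autonomy

variable {ι : Type*}

/-- **Conditional conservation of the block energies.**  If every collision of a good torus orbit
at a time of `(a, t]` is between two particles of the same block, the kinetic energy of every
block is the same at times `t` and `a` (orbit induction: free flight keeps the velocities, an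
intra-block elastic collision keeps `‖v_p‖² + ‖v_q‖²`). [folklore] -/
theorem blockEnergy_flow_eq_of_intra (Φ : HardSphereFlow (Torus.geometry d) ε N)
    {z : Config N d (UnitAddTorus d)} (hz : z ∈ Φ.good) (cl : Fin N → ι) {a b : ℝ} :
    ∀ t ∈ Icc a b, (∀ s ∈ collisionTimes (Torus.geometry d) ε (fun t => Φ.flow t z) ∩ Ioc a t,
      ∀ i j, i ≠ j → Φ.flow s z ∈ contactSet (Torus.geometry d) N ε i j → cl i = cl j) →
      ∀ α, (∑ k, if cl k = α then ‖(Φ.flow t z k).2‖ ^ 2 else 0) =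
        ∑ k, if cl k = α then ‖(Φ.flow a z k).2‖ ^ 2 else 0 := by
  have hγ := Φ.isTrajectory z hz
  have hG : ∀ x : UnitAddTorus d, Continuous ((Torus.geometry d).translate x) :=
    Torus.continuous_geometry_translate
  refine window_induction hγ (fun t =>
    (∀ s ∈ collisionTimes (Torus.geometry d) ε (fun t => Φ.flow t z) ∩ Ioc a t,
      ∀ i j, i ≠ j → Φ.flow s z ∈ contactSet (Torus.geometry d) N ε i j → cl i = cl j) →
      ∀ α, (∑ k, if cl k = α then ‖(Φ.flow t z k).2‖ ^ 2 else 0) =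
        ∑ k, if cl k = α then ‖(Φ.flow a z k).2‖ ^ 2 else 0) (fun _ _ => rfl) ?_ ?_
  · intro s t has hst htb hQs hfr hintra α
    have hQs' := hQs (fun s' hs' => hintra s' ⟨hs'.1, hs'.2.1, hs'.2.2.trans hst⟩) α
    have hff : Φ.flow t z = freeFlight (Torus.geometry d) (t - s) (Φ.flow s z) :=
      hγ.free s t hst hfr
    rw [hff, blockEnergy_freeFlight]
    exact hQs'
  · intro s t has hst htb hQs hfr htc hintra α
    obtain ⟨p, q, hpq, hc, -, heq⟩ := exists_eq_collidePair_freeFlight hγ hG hst hfr htc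
    have hcl : cl p = cl q := hintra t ⟨htc, has.trans_lt hst, le_rfl⟩ p q hpq hc
    have hQs' := hQs (fun s' hs' => hintra s' ⟨hs'.1, hs'.2.1, hs'.2.2.trans hst.le⟩) α
    have heq' : Φ.flow t z =
        collidePair (Torus.geometry d) p q (freeFlight (Torus.geometry d) (t - s) (Φ.flow s z)) :=
      heq
    rw [heq', blockEnergy_collidePair (Torus.geometry d) cl hpq hcl, blockEnergy_freeFlight]
    exact hQs'

/-- **Energy-separated blocks of a hard-sphere orbit on the torus are autonomous during a short
window** (registered sub-goal `stub_eqMomentClusterAutonomy` of stub `stub_eqMoment`, line `Sketch`,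
stmt-AtomisticToContinuum-12097).  For a labelling `cl` of the particles into blocks such that at
time `a` particles of different blocks are at minimal-image distance
`> ε + (b - a)(√(2E_{cl i}) + √(2E_{cl j}))` (`2E_α = Σ_{cl k = α} ‖v_k(a)‖²`): (1) every collision at
a time of `[a, b]` is intra-block; (2) block kinetic energies are conserved on `[a, b]`; (3) speeds
are bounded by `√(2E)` of the own block on `[a, b]`; (4) displacements from time `a` are bounded by
`(t - a) √(2E)` of the own block.  At the least cross-block collision time `s⋆ ∈ [a, b]` the earlier
collisions are intra-block, so (2)–(4) hold on `[a, s⋆)` and the two colliders, `ε` apart at `s⋆`,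
were `≤ ε + (s⋆ - a)(√(2E_{cl i}) + √(2E_{cl j}))` apart at time `a` — a contradiction. [folklore] -/
theorem stub_eqMomentClusterAutonomy {d : Type*} [Fintype d] {N : ℕ} {ε : ℝ} {ι : Type*}
    (Φ : HardSphereFlow (Torus.geometry d) ε N)
    {z : Config N d (UnitAddTorus d)} (hz : z ∈ Φ.good) (cl : Fin N → ι) {a b : ℝ}
    (hsep : ∀ i j, cl i ≠ cl j →
      ε + (b - a) * (Real.sqrt (∑ k, if cl k = cl i then ‖(Φ.flow a z k).2‖ ^ 2 else 0) +
        Real.sqrt (∑ k, if cl k = cl j then ‖(Φ.flow a z k).2‖ ^ 2 else 0)) <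
      Torus.euclidDist (Φ.flow a z i).1 (Φ.flow a z j).1) :
    (∀ s ∈ collisionTimes (Torus.geometry d) ε (fun t => Φ.flow t z) ∩ Icc a b, ∀ i j, i ≠ j →
      Φ.flow s z ∈ contactSet (Torus.geometry d) N ε i j → cl i = cl j) ∧
    (∀ t ∈ Icc a b, ∀ i, (∑ k, if cl k = cl i then ‖(Φ.flow t z k).2‖ ^ 2 else 0) =
      ∑ k, if cl k = cl i then ‖(Φ.flow a z k).2‖ ^ 2 else 0) ∧
    (∀ t ∈ Icc a b, ∀ i, ‖(Φ.flow t z i).2‖ ≤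
      Real.sqrt (∑ k, if cl k = cl i then ‖(Φ.flow a z k).2‖ ^ 2 else 0)) ∧
    (∀ t ∈ Icc a b, ∀ i, Torus.euclidDist (Φ.flow t z i).1 (Φ.flow a z i).1 ≤
      (t - a) * Real.sqrt (∑ k, if cl k = cl i then ‖(Φ.flow a z k).2‖ ^ 2 else 0)) := by
  have hγ := Φ.isTrajectory z hz
  have step1 := blockEnergy_flow_eq_of_intra Φ hz cl (a := a) (b := b)
  -- Step 2: all collisions in `[a, b]` are intra-block (first cross-block collision argument)
  have hC1 : ∀ s ∈ collisionTimes (Torus.geometry d) ε (fun t => Φ.flow t z) ∩ Icc a b,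
      ∀ i j, i ≠ j → Φ.flow s z ∈ contactSet (Torus.geometry d) N ε i j → cl i = cl j := by
    by_contra hbad
    push Not at hbad
    obtain ⟨s₁, hs₁, i₁, j₁, hij₁, hc₁, hcl₁⟩ := hbad
    -- the finite, nonempty set of cross-block collision times in `[a, b]`, and its least element
    have hBfin : {s | s ∈ collisionTimes (Torus.geometry d) ε (fun t => Φ.flow t z) ∩ Icc a b ∧
        ∃ i j : Fin N, i ≠ j ∧ Φ.flow s z ∈ contactSet (Torus.geometry d) N ε i j ∧
          cl i ≠ cl j}.Finite :=
      (hγ.locFinite a b).subset fun s hs => hs.1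
    have hBne : hBfin.toFinset.Nonempty := ⟨s₁, hBfin.mem_toFinset.2 ⟨hs₁, i₁, j₁, hij₁, hc₁, hcl₁⟩⟩
    obtain ⟨⟨hsc, hsa, hsb⟩, i, j, hij, hc, hclij⟩ :=
      hBfin.mem_toFinset.1 (hBfin.toFinset.min'_mem hBne)
    have hmin : ∀ s' ∈ collisionTimes (Torus.geometry d) ε (fun t => Φ.flow t z) ∩ Icc a b,
        ∀ i' j', i' ≠ j' → Φ.flow s' z ∈ contactSet (Torus.geometry d) N ε i' j' → cl i' ≠ cl j' →
        hBfin.toFinset.min' hBne ≤ s' := fun s' hs' i' j' hij' hc' hne =>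
      hBfin.toFinset.min'_le s' (hBfin.mem_toFinset.2 ⟨hs', i', j', hij', hc', hne⟩)
    -- before the least cross-block collision time, all collisions are intra-block
    have hintra : ∀ s, s < hBfin.toFinset.min' hBne →
        ∀ s' ∈ collisionTimes (Torus.geometry d) ε (fun t => Φ.flow t z) ∩ Ioc a s,
        ∀ i' j', i' ≠ j' → Φ.flow s' z ∈ contactSet (Torus.geometry d) N ε i' j' → cl i' = cl j' := by
      intro s hs s' hs' i' j' hij' hc'
      by_contra hne
      have := hmin s' ⟨hs'.1, hs'.2.1.le, (hs'.2.2.trans hs.le).trans hsb⟩ i' j' hij' hc' hne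
      linarith [hs'.2.2]
    -- hence speeds are bounded by the (conserved) block energies on `[a, s⋆)`
    have hv : ∀ s ∈ Ico a (hBfin.toFinset.min' hBne), ∀ k, ‖(Φ.flow s z k).2‖ ≤
        Real.sqrt (∑ l, if cl l = cl k then ‖(Φ.flow a z l).2‖ ^ 2 else 0) := by
      intro s hs k
      rw [← step1 s ⟨hs.1, hs.2.le.trans hsb⟩ (hintra s hs.2) (cl k)]
      exact norm_vel_le_sqrt_blockEnergy cl (Φ.flow s z) k
    -- displacements of the two colliders up to `s⋆`
    have hdi := euclidDist_flow_le_of_norm_vel_le Φ hz i hsa fun s hs => hv s hs i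
    have hdj := euclidDist_flow_le_of_norm_vel_le Φ hz j hsa fun s hs => hv s hs j
    -- contact at `s⋆` versus separation at `a`
    have hdist : Torus.euclidDist (Φ.flow (hBfin.toFinset.min' hBne) z i).1
        (Φ.flow (hBfin.toFinset.min' hBne) z j).1 = ε := by
      rw [← Torus.norm_geometry_sepVec]; exact (mem_contactSet.1 hc).2
    have hsep' := hsep i j hclij
    have htri := euclidDist_sub_sub_le (Φ.flow (hBfin.toFinset.min' hBne) z i).1
      (Φ.flow (hBfin.toFinset.min' hBne) z j).1 (Φ.flow a z i).1 (Φ.flow a z j).1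
    have hEi : 0 ≤ Real.sqrt (∑ l, if cl l = cl i then ‖(Φ.flow a z l).2‖ ^ 2 else 0) :=
      Real.sqrt_nonneg _
    have hEj : 0 ≤ Real.sqrt (∑ l, if cl l = cl j then ‖(Φ.flow a z l).2‖ ^ 2 else 0) :=
      Real.sqrt_nonneg _
    have hsa' : hBfin.toFinset.min' hBne - a ≤ b - a := by linarith
    have h1 := mul_le_mul_of_nonneg_left hsa' hEi
    have h2 := mul_le_mul_of_nonneg_left hsa' hEj
    linarith
  -- Step 3: the four conclusions
  have hC2 : ∀ t ∈ Icc a b, ∀ i, (∑ k, if cl k = cl i then ‖(Φ.flow t z k).2‖ ^ 2 else 0) =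
      ∑ k, if cl k = cl i then ‖(Φ.flow a z k).2‖ ^ 2 else 0 := fun t ht i =>
    step1 t ht (fun s hs => hC1 s ⟨hs.1, hs.2.1.le, hs.2.2.trans ht.2⟩) (cl i)
  have hC3 : ∀ t ∈ Icc a b, ∀ i, ‖(Φ.flow t z i).2‖ ≤
      Real.sqrt (∑ k, if cl k = cl i then ‖(Φ.flow a z k).2‖ ^ 2 else 0) := by
    intro t ht i
    rw [← hC2 t ht i]
    exact norm_vel_le_sqrt_blockEnergy cl (Φ.flow t z) i
  refine ⟨hC1, hC2, hC3, fun t ht i => ?_⟩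
  rw [mul_comm]
  exact euclidDist_flow_le_of_norm_vel_le Φ hz i ht.1 fun s hs => hC3 s ⟨hs.1, hs.2.le.trans ht.2⟩ i

end Autonomy

end Summit.AtomisticToContinuum.HydrodynamicLimit.Theorems.ContactAngleEquidistributionSketch

end
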